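import Mathlib
import Summits.MatrixMultiplication.MatrixMultiplication.Theses.ConeDesigns

/-!
# Route ConeDesigns — support `RankThreeAtMostTwo` (item `stmt-MatrixMultiplication-9766`)

For every prime `q ≥ 7`, a cone STPP design of nonzero vectors in `(ZMod q)^3` — `N` labelled
triangles `(a i, b i, c i)` whose punctured lines `𝔽_q^× a i, 𝔽_q^× b i, 𝔽_q^× c i` satisfy the
simultaneous triple product property `IsSTPP` (Cohn–Kleinberg–Szegedy–Umans 2005, Def. 5.1) — has
at most two triangles.

## Proof

* From `IsSTPP` of the cone family we extract two scalar statements: the *hexagon property*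
  (for `(i,j,k)` not all equal and nonzero scalars `l₀,…,l₅`,
  `l₀ a_i + l₁ a_k + l₂ b_j + l₃ b_i + l₄ c_k + l₅ c_j ≠ 0`) and the *triangle property*
  (each `(a_i, b_i, c_i)` is linearly independent; uses `2 ≠ 0`).
* Both statements are invariant under a linear automorphism of `𝔽_q^3`, so we may move the first
  triangle to the standard basis `(e₀, e₁, e₂)` (`Module.Basis.equivFun`).
* In coordinates, the three hexagons `(0,0,1)`, `(0,1,0)`, `(1,0,0)` force the second triangle to
  be, line by line, a non-trivial cyclic relabelling of the first (`(e₂,e₀,e₁)` or `(e₁,e₂,e₀)` up to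
  scalars); the same holds for a third triangle, and then one of the hexagons `(1,1,2)`, `(0,1,2)`,
  `(0,2,1)` carries an explicit nowhere-zero linear dependency — contradiction. The explicit
  witnesses only need `2 ≠ 0` and four distinct field elements (`q ≥ 5`); the item asks `q ≥ 7`.

Source of the statement: CKSU 2005 (arXiv:math/0511460) §5, Prop. 5.2 (the rank-three example);
the rigidity argument is elementary projective geometry in `PG(2,q)`.
-/

set_option linter.dupNamespace false

namespace Summit.MatrixMultiplication.MatrixMultiplication.Theorems

open Literature.Computability.AlgebraicComplexity

/-! ## Scalar lemmas -/

/-- In a field with `2 ≠ 0` every element is a sum of two nonzero elements. -/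
theorem coneR3_split {K : Type*} [Field K] (h2 : (2 : K) ≠ 0) (v : K) :
    ∃ s t : K, s ≠ 0 ∧ t ≠ 0 ∧ s + t = v := by
  by_cases hv : v = 0
  · exact ⟨1, -1, one_ne_zero, neg_ne_zero.2 one_ne_zero, by simp [hv]⟩
  · refine ⟨v / 2, v / 2, div_ne_zero hv h2, div_ne_zero hv h2, ?_⟩
    field_simp
    ring

/-- Avoiding the root of an affine form: if `(x, y) ≠ (0, 0)` and `μ ≠ -x / y`, then
`x + μ * y ≠ 0`. -/
theorem coneR3_affine_ne {K : Type*} [Field K] {x y μ : K} (hxy : x = 0 → y ≠ 0)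
    (hμ : μ ≠ -x / y) : x + μ * y ≠ 0 := by
  intro h
  by_cases hy : y = 0
  · subst hy
    have hx : x = 0 := by simpa using h
    exact hxy hx rfl
  · apply hμ
    rw [eq_div_iff hy]
    linear_combination h

/-- In `ZMod q` with `q ≥ 7` (indeed `q ≥ 4`) any three values can be simultaneously avoided. -/
theorem coneR3_avoid {q : ℕ} [Fact q.Prime] (hq : 7 ≤ q) (v₁ v₂ v₃ : ZMod q) :
    ∃ μ : ZMod q, μ ≠ v₁ ∧ μ ≠ v₂ ∧ μ ≠ v₃ := by
  classical
  have hlt : ({v₁, v₂, v₃} : Finset (ZMod q)).card < (Finset.univ : Finset (ZMod q)).card := by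
    calc ({v₁, v₂, v₃} : Finset (ZMod q)).card ≤ 3 := Finset.card_le_three
      _ < q := by omega
      _ = (Finset.univ : Finset (ZMod q)).card := by simp [ZMod.card]
  obtain ⟨μ, -, hμ⟩ := Finset.exists_mem_notMem_of_card_lt_card hlt
  simp only [Finset.mem_insert, Finset.mem_singleton, not_or] at hμ
  exact ⟨μ, hμ.1, hμ.2.1, hμ.2.2⟩

/-- `2 ≠ 0` in `ZMod q` for a prime `q ≥ 7`. -/
theorem coneR3_two_ne_zero {q : ℕ} [Fact q.Prime] (hq : 7 ≤ q) : (2 : ZMod q) ≠ 0 := by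
  have h : ((2 : ℕ) : ZMod q) ≠ 0 := by
    rw [Ne, ZMod.natCast_eq_zero_iff]
    intro hd
    have := Nat.le_of_dvd (by norm_num) hd
    omega
  simpa using h

/-! ## From `IsSTPP` of a cone family to scalar statements -/

/-- A nonzero multiple of a nonzero vector lies on its punctured line. -/
theorem coneR3_mem_cone {q : ℕ} [Fact q.Prime] {n : ℕ} {v : Fin n → ZMod q} (hv : v ≠ 0)
    {t : ZMod q} (ht : t ≠ 0) :
    t • v ∈ ((Finset.univ : Finset (ZMod q)).image (fun s => s • v)).erase 0 := by
  rw [Finset.mem_erase]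
  exact ⟨smul_ne_zero ht hv, Finset.mem_image_of_mem _ (Finset.mem_univ t)⟩

/-- **Hexagon property** of a cone STPP design: for `(i, j, k)` not all equal and nonzero scalars
`l₀, …, l₅`, the vector `l₀ a_i + l₁ a_k + l₂ b_j + l₃ b_i + l₄ c_k + l₅ c_j` is nonzero
(take `s' = l₀ a_i`, `s = -l₁ a_k`, `t' = l₂ b_j`, `t = -l₃ b_i`, `u' = l₄ c_k`, `u = -l₅ c_j` in
Def. 5.1). -/
theorem coneR3_hexagon {q : ℕ} [Fact q.Prime] {n N : ℕ} {a b c : Fin N → Fin n → ZMod q}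
    (hnz : ∀ i, a i ≠ 0 ∧ b i ≠ 0 ∧ c i ≠ 0)
    (hS : IsSTPP (fun i => ((Finset.univ : Finset (ZMod q)).image (fun t => t • a i)).erase 0)
      (fun i => ((Finset.univ : Finset (ZMod q)).image (fun t => t • b i)).erase 0)
      (fun i => ((Finset.univ : Finset (ZMod q)).image (fun t => t • c i)).erase 0))
    (i j k : Fin N) (hijk : ¬ (i = j ∧ j = k)) (l₀ l₁ l₂ l₃ l₄ l₅ : ZMod q)
    (h₀ : l₀ ≠ 0) (h₁ : l₁ ≠ 0) (h₂ : l₂ ≠ 0) (h₃ : l₃ ≠ 0) (h₄ : l₄ ≠ 0) (h₅ : l₅ ≠ 0) :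
    l₀ • a i + l₁ • a k + l₂ • b j + l₃ • b i + l₄ • c k + l₅ • c j ≠ 0 := by
  intro h
  have := hS i j k ((-l₁) • a k) (coneR3_mem_cone (hnz k).1 (neg_ne_zero.2 h₁))
    (l₀ • a i) (coneR3_mem_cone (hnz i).1 h₀)
    ((-l₃) • b i) (coneR3_mem_cone (hnz i).2.1 (neg_ne_zero.2 h₃))
    (l₂ • b j) (coneR3_mem_cone (hnz j).2.1 h₂)
    ((-l₅) • c j) (coneR3_mem_cone (hnz j).2.2 (neg_ne_zero.2 h₅))
    (l₄ • c k) (coneR3_mem_cone (hnz k).2.2 h₄)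
    (by rw [← h]; simp only [neg_smul, sub_neg_eq_add]; abel)
  exact hijk ⟨this.1, this.2.1⟩

/-- **Triangle property** of a cone STPP design (`q` odd): each triangle `(a_i, b_i, c_i)` is
linearly independent, in the form "every vanishing combination is trivial" (split each coefficient
as a sum of two nonzero scalars and apply the triple product property `i = j = k`). -/
theorem coneR3_triangle {q : ℕ} [Fact q.Prime] (h2 : (2 : ZMod q) ≠ 0) {n N : ℕ}
    {a b c : Fin N → Fin n → ZMod q}
    (hnz : ∀ i, a i ≠ 0 ∧ b i ≠ 0 ∧ c i ≠ 0)
    (hS : IsSTPP (fun i => ((Finset.univ : Finset (ZMod q)).image (fun t => t • a i)).erase 0)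
      (fun i => ((Finset.univ : Finset (ZMod q)).image (fun t => t • b i)).erase 0)
      (fun i => ((Finset.univ : Finset (ZMod q)).image (fun t => t • c i)).erase 0))
    (i : Fin N) (μ₀ μ₁ μ₂ : ZMod q) (h : μ₀ • a i + μ₁ • b i + μ₂ • c i = 0) :
    μ₀ = 0 ∧ μ₁ = 0 ∧ μ₂ = 0 := by
  obtain ⟨s₀, t₀, hs₀, ht₀, e₀⟩ := coneR3_split h2 μ₀
  obtain ⟨s₁, t₁, hs₁, ht₁, e₁⟩ := coneR3_split h2 μ₁
  obtain ⟨s₂, t₂, hs₂, ht₂, e₂⟩ := coneR3_split h2 μ₂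
  have := hS i i i ((-t₀) • a i) (coneR3_mem_cone (hnz i).1 (neg_ne_zero.2 ht₀))
    (s₀ • a i) (coneR3_mem_cone (hnz i).1 hs₀)
    ((-t₁) • b i) (coneR3_mem_cone (hnz i).2.1 (neg_ne_zero.2 ht₁))
    (s₁ • b i) (coneR3_mem_cone (hnz i).2.1 hs₁)
    ((-t₂) • c i) (coneR3_mem_cone (hnz i).2.2 (neg_ne_zero.2 ht₂))
    (s₂ • c i) (coneR3_mem_cone (hnz i).2.2 hs₂)
    (by rw [← h, ← e₀, ← e₁, ← e₂]; simp only [neg_smul, sub_neg_eq_add, add_smul])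
  obtain ⟨-, -, ha, hb, hc⟩ := this
  have ha' : μ₀ • a i = 0 := by
    rw [← e₀, add_smul, ← sub_eq_zero, ← ha]; simp
  have hb' : μ₁ • b i = 0 := by
    rw [← e₁, add_smul, ← sub_eq_zero, ← hb]; simp
  have hc' : μ₂ • c i = 0 := by
    rw [← e₂, add_smul, ← sub_eq_zero, ← hc]; simp
  exact ⟨(smul_eq_zero.1 ha').resolve_right (hnz i).1,
    (smul_eq_zero.1 hb').resolve_right (hnz i).2.1,
    (smul_eq_zero.1 hc').resolve_right (hnz i).2.2⟩

/-! ## Coordinate lemmas in `K³` with the first triangle at the standard basis -/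

/-- Evaluating a six-term combination of vectors at a coordinate. -/
theorem coneR3_eval {K : Type*} [Field K] (l₀ l₁ l₂ l₃ l₄ l₅ : K)
    (v₀ v₁ v₂ v₃ v₄ v₅ : Fin 3 → K) (j : Fin 3) :
    (l₀ • v₀ + l₁ • v₁ + l₂ • v₂ + l₃ • v₃ + l₄ • v₄ + l₅ • v₅) j
      = l₀ * v₀ j + l₁ * v₁ j + l₂ * v₂ j + l₃ * v₃ j + l₄ * v₄ j + l₅ * v₅ j := by
  simp only [Pi.add_apply, Pi.smul_apply, smul_eq_mul]

/-- A six-term combination of vectors of `K³` vanishes once its three coordinates do. -/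
theorem coneR3_comb_eq_zero {K : Type*} [Field K] {l₀ l₁ l₂ l₃ l₄ l₅ : K}
    {v₀ v₁ v₂ v₃ v₄ v₅ : Fin 3 → K}
    (h0 : l₀ * v₀ 0 + l₁ * v₁ 0 + l₂ * v₂ 0 + l₃ * v₃ 0 + l₄ * v₄ 0 + l₅ * v₅ 0 = 0)
    (h1 : l₀ * v₀ 1 + l₁ * v₁ 1 + l₂ * v₂ 1 + l₃ * v₃ 1 + l₄ * v₄ 1 + l₅ * v₅ 1 = 0)
    (h2 : l₀ * v₀ 2 + l₁ * v₁ 2 + l₂ * v₂ 2 + l₃ * v₃ 2 + l₄ * v₄ 2 + l₅ * v₅ 2 = 0) :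
    l₀ • v₀ + l₁ • v₁ + l₂ • v₂ + l₃ • v₃ + l₄ • v₄ + l₅ • v₅ = 0 := by
  funext j
  rw [coneR3_eval, Pi.zero_apply]
  fin_cases j
  exacts [h0, h1, h2]

/-- Hexagon `(0,0,1)` against the standard triangle: if no nowhere-zero combination of
`e₀, x, e₁, e₁, z, e₂` vanishes then `x, z` both lie on the side `⟨e₁, e₂⟩` or both on
`⟨e₀, e₁⟩`. -/
theorem coneR3_hex001 {K : Type*} [Field K] (h2 : (2 : K) ≠ 0)
    (havoid : ∀ v₁ v₂ v₃ : K, ∃ μ : K, μ ≠ v₁ ∧ μ ≠ v₂ ∧ μ ≠ v₃) (x z : Fin 3 → K)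
    (h : ∀ l₀ l₁ l₂ l₃ l₄ l₅ : K, l₀ ≠ 0 → l₁ ≠ 0 → l₂ ≠ 0 → l₃ ≠ 0 → l₄ ≠ 0 → l₅ ≠ 0 →
      l₀ • (![1, 0, 0] : Fin 3 → K) + l₁ • x + l₂ • (![0, 1, 0] : Fin 3 → K)
        + l₃ • (![0, 1, 0] : Fin 3 → K) + l₄ • z + l₅ • (![0, 0, 1] : Fin 3 → K) ≠ 0) :
    (x 0 = 0 ∧ z 0 = 0) ∨ (x 2 = 0 ∧ z 2 = 0) := by
  by_contra hc
  push Not at hc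
  obtain ⟨μ, hμ0, hμa, hμb⟩ := havoid 0 (-x 0 / z 0) (-x 2 / z 2)
  have hA : x 0 + μ * z 0 ≠ 0 := coneR3_affine_ne hc.1 hμa
  have hB : x 2 + μ * z 2 ≠ 0 := coneR3_affine_ne hc.2 hμb
  obtain ⟨s, t, hs, ht, hst⟩ := coneR3_split h2 (-(x 1 + μ * z 1))
  obtain rfl : t = -(x 1 + μ * z 1) - s := by linear_combination hst
  refine h (-(x 0 + μ * z 0)) 1 s (-(x 1 + μ * z 1) - s) μ (-(x 2 + μ * z 2))
    (neg_ne_zero.2 hA) one_ne_zero hs ht hμ0 (neg_ne_zero.2 hB) (coneR3_comb_eq_zero ?_ ?_ ?_) <;>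
  (simp only [Matrix.cons_val_zero, Matrix.cons_val_one, Matrix.cons_val_two, Matrix.head_cons,
      Matrix.tail_cons]; ring)

/-- Hexagon `(0,1,0)` against the standard triangle: if no nowhere-zero combination of
`e₀, e₀, y, e₁, e₂, z` vanishes then `y, z` both lie on `⟨e₀, e₂⟩` or both on `⟨e₀, e₁⟩`. -/
theorem coneR3_hex010 {K : Type*} [Field K] (h2 : (2 : K) ≠ 0)
    (havoid : ∀ v₁ v₂ v₃ : K, ∃ μ : K, μ ≠ v₁ ∧ μ ≠ v₂ ∧ μ ≠ v₃) (y z : Fin 3 → K)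
    (h : ∀ l₀ l₁ l₂ l₃ l₄ l₅ : K, l₀ ≠ 0 → l₁ ≠ 0 → l₂ ≠ 0 → l₃ ≠ 0 → l₄ ≠ 0 → l₅ ≠ 0 →
      l₀ • (![1, 0, 0] : Fin 3 → K) + l₁ • (![1, 0, 0] : Fin 3 → K) + l₂ • y
        + l₃ • (![0, 1, 0] : Fin 3 → K) + l₄ • (![0, 0, 1] : Fin 3 → K) + l₅ • z ≠ 0) :
    (y 1 = 0 ∧ z 1 = 0) ∨ (y 2 = 0 ∧ z 2 = 0) := by
  by_contra hc
  push Not at hc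
  obtain ⟨μ, hμ0, hμa, hμb⟩ := havoid 0 (-y 1 / z 1) (-y 2 / z 2)
  have hA : y 1 + μ * z 1 ≠ 0 := coneR3_affine_ne hc.1 hμa
  have hB : y 2 + μ * z 2 ≠ 0 := coneR3_affine_ne hc.2 hμb
  obtain ⟨s, t, hs, ht, hst⟩ := coneR3_split h2 (-(y 0 + μ * z 0))
  obtain rfl : t = -(y 0 + μ * z 0) - s := by linear_combination hst
  refine h s (-(y 0 + μ * z 0) - s) 1 (-(y 1 + μ * z 1)) (-(y 2 + μ * z 2)) μ
    hs ht one_ne_zero (neg_ne_zero.2 hA) (neg_ne_zero.2 hB) hμ0 (coneR3_comb_eq_zero ?_ ?_ ?_) <;>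
  (simp only [Matrix.cons_val_zero, Matrix.cons_val_one, Matrix.cons_val_two, Matrix.head_cons,
      Matrix.tail_cons]; ring)

/-- Hexagon `(1,0,0)` against the standard triangle: if no nowhere-zero combination of
`x, e₀, e₁, y, e₂, e₂` vanishes then `x, y` both lie on `⟨e₁, e₂⟩` or both on `⟨e₀, e₂⟩`. -/
theorem coneR3_hex100 {K : Type*} [Field K] (h2 : (2 : K) ≠ 0)
    (havoid : ∀ v₁ v₂ v₃ : K, ∃ μ : K, μ ≠ v₁ ∧ μ ≠ v₂ ∧ μ ≠ v₃) (x y : Fin 3 → K)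
    (h : ∀ l₀ l₁ l₂ l₃ l₄ l₅ : K, l₀ ≠ 0 → l₁ ≠ 0 → l₂ ≠ 0 → l₃ ≠ 0 → l₄ ≠ 0 → l₅ ≠ 0 →
      l₀ • x + l₁ • (![1, 0, 0] : Fin 3 → K) + l₂ • (![0, 1, 0] : Fin 3 → K) + l₃ • y
        + l₄ • (![0, 0, 1] : Fin 3 → K) + l₅ • (![0, 0, 1] : Fin 3 → K) ≠ 0) :
    (x 0 = 0 ∧ y 0 = 0) ∨ (x 1 = 0 ∧ y 1 = 0) := by
  by_contra hc
  push Not at hc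
  obtain ⟨μ, hμ0, hμa, hμb⟩ := havoid 0 (-x 0 / y 0) (-x 1 / y 1)
  have hA : x 0 + μ * y 0 ≠ 0 := coneR3_affine_ne hc.1 hμa
  have hB : x 1 + μ * y 1 ≠ 0 := coneR3_affine_ne hc.2 hμb
  obtain ⟨s, t, hs, ht, hst⟩ := coneR3_split h2 (-(x 2 + μ * y 2))
  obtain rfl : t = -(x 2 + μ * y 2) - s := by linear_combination hst
  refine h 1 (-(x 0 + μ * y 0)) (-(x 1 + μ * y 1)) μ s (-(x 2 + μ * y 2) - s)
    one_ne_zero (neg_ne_zero.2 hA) (neg_ne_zero.2 hB) hμ0 hs ht (coneR3_comb_eq_zero ?_ ?_ ?_) <;>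
  (simp only [Matrix.cons_val_zero, Matrix.cons_val_one, Matrix.cons_val_two, Matrix.head_cons,
      Matrix.tail_cons]; ring)

/-- The triangle property in coordinates: "every vanishing combination of `x, y, z` is trivial"
gives `det (x, y, z) ≠ 0` (cofactor expansion along the first row). -/
theorem coneR3_det_ne_zero {K : Type*} [Field K] (x y z : Fin 3 → K)
    (hind : ∀ μ₀ μ₁ μ₂ : K, μ₀ • x + μ₁ • y + μ₂ • z = 0 → μ₀ = 0 ∧ μ₁ = 0 ∧ μ₂ = 0) :
    x 0 * (y 1 * z 2 - y 2 * z 1) - x 1 * (y 0 * z 2 - y 2 * z 0)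
      + x 2 * (y 0 * z 1 - y 1 * z 0) ≠ 0 := by
  classical
  intro hD
  have hdet : (Matrix.of ![x, y, z]).det = 0 := by
    rw [Matrix.det_fin_three]
    simp only [Matrix.of_apply, Matrix.cons_val_zero, Matrix.cons_val_one, Matrix.cons_val_two,
      Matrix.head_cons, Matrix.tail_cons]
    linear_combination hD
  obtain ⟨μ, hμ, hμM⟩ := Matrix.exists_vecMul_eq_zero_iff.2 hdet
  have hcomb : μ 0 • x + μ 1 • y + μ 2 • z = 0 := by
    ext j
    have := congrFun hμM j
    simpa [Matrix.vecMul, dotProduct, Fin.sum_univ_three] using this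
  obtain ⟨h0, h1, h2⟩ := hind _ _ _ hcomb
  apply hμ
  ext j
  fin_cases j <;> simp [h0, h1, h2]

/-- **Rigidity of STPP pairs in rank three.** With the first triangle at `(e₀, e₁, e₂)`, the three
hexagon consequences and `det ≠ 0` force the second triangle `(x, y, z)` to be, up to scalars,
`(e₂, e₀, e₁)` or `(e₁, e₂, e₀)`. -/
theorem coneR3_pair {K : Type*} [Field K] {x y z : Fin 3 → K}
    (hD : x 0 * (y 1 * z 2 - y 2 * z 1) - x 1 * (y 0 * z 2 - y 2 * z 0)
      + x 2 * (y 0 * z 1 - y 1 * z 0) ≠ 0)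
    (h₁ : (x 0 = 0 ∧ z 0 = 0) ∨ (x 2 = 0 ∧ z 2 = 0))
    (h₂ : (y 1 = 0 ∧ z 1 = 0) ∨ (y 2 = 0 ∧ z 2 = 0))
    (h₃ : (x 0 = 0 ∧ y 0 = 0) ∨ (x 1 = 0 ∧ y 1 = 0)) :
    (x 0 = 0 ∧ x 1 = 0 ∧ y 1 = 0 ∧ y 2 = 0 ∧ z 0 = 0 ∧ z 2 = 0 ∧ x 2 ≠ 0 ∧ y 0 ≠ 0 ∧ z 1 ≠ 0) ∨
    (x 0 = 0 ∧ x 2 = 0 ∧ y 0 = 0 ∧ y 1 = 0 ∧ z 1 = 0 ∧ z 2 = 0 ∧ x 1 ≠ 0 ∧ y 2 ≠ 0 ∧ z 0 ≠ 0) := by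
  rcases h₁ with ⟨_, _⟩ | ⟨_, _⟩ <;> rcases h₂ with ⟨_, _⟩ | ⟨_, _⟩ <;>
    rcases h₃ with ⟨_, _⟩ | ⟨_, _⟩ <;> simp_all

/-- **Three triangles are impossible.** Two triangles, each a non-trivial cyclic relabelling of the
standard one (conclusion of `coneR3_pair`), violate one of the hexagons `(1,1,2)`, `(0,1,2)`,
`(0,2,1)` by an explicit nowhere-zero dependency (uses `2 ≠ 0`). -/
theorem coneR3_triple {K : Type*} [Field K] (h2 : (2 : K) ≠ 0) {x y z u v w : Fin 3 → K}
    (hT₁ : (x 0 = 0 ∧ x 1 = 0 ∧ y 1 = 0 ∧ y 2 = 0 ∧ z 0 = 0 ∧ z 2 = 0 ∧ x 2 ≠ 0 ∧ y 0 ≠ 0 ∧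
        z 1 ≠ 0) ∨
      (x 0 = 0 ∧ x 2 = 0 ∧ y 0 = 0 ∧ y 1 = 0 ∧ z 1 = 0 ∧ z 2 = 0 ∧ x 1 ≠ 0 ∧ y 2 ≠ 0 ∧ z 0 ≠ 0))
    (hT₂ : (u 0 = 0 ∧ u 1 = 0 ∧ v 1 = 0 ∧ v 2 = 0 ∧ w 0 = 0 ∧ w 2 = 0 ∧ u 2 ≠ 0 ∧ v 0 ≠ 0 ∧
        w 1 ≠ 0) ∨
      (u 0 = 0 ∧ u 2 = 0 ∧ v 0 = 0 ∧ v 1 = 0 ∧ w 1 = 0 ∧ w 2 = 0 ∧ u 1 ≠ 0 ∧ v 2 ≠ 0 ∧ w 0 ≠ 0))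
    (h112 : ∀ l₀ l₁ l₂ l₃ l₄ l₅ : K, l₀ ≠ 0 → l₁ ≠ 0 → l₂ ≠ 0 → l₃ ≠ 0 → l₄ ≠ 0 → l₅ ≠ 0 →
      l₀ • x + l₁ • u + l₂ • y + l₃ • y + l₄ • w + l₅ • z ≠ 0)
    (h012 : ∀ l₀ l₁ l₂ l₃ l₄ l₅ : K, l₀ ≠ 0 → l₁ ≠ 0 → l₂ ≠ 0 → l₃ ≠ 0 → l₄ ≠ 0 → l₅ ≠ 0 →
      l₀ • (![1, 0, 0] : Fin 3 → K) + l₁ • u + l₂ • y + l₃ • (![0, 1, 0] : Fin 3 → K)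
        + l₄ • w + l₅ • z ≠ 0)
    (h021 : ∀ l₀ l₁ l₂ l₃ l₄ l₅ : K, l₀ ≠ 0 → l₁ ≠ 0 → l₂ ≠ 0 → l₃ ≠ 0 → l₄ ≠ 0 → l₅ ≠ 0 →
      l₀ • (![1, 0, 0] : Fin 3 → K) + l₁ • x + l₂ • v + l₃ • (![0, 1, 0] : Fin 3 → K)
        + l₄ • z + l₅ • w ≠ 0) : False := by
  have h1 : (-1 : K) ≠ 0 := neg_ne_zero.2 one_ne_zero
  rcases hT₁ with ⟨hx0, hx1, hy1, hy2, hz0, hz2, hx2, hy0, hz1⟩ |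
      ⟨hx0, hx2, -, -, hz1, hz2, hx1, -, hz0⟩ <;>
    rcases hT₂ with ⟨hu0, hu1, hv1, hv2, hw0, hw2, hu2, hv0, hw1⟩ |
      ⟨hu0, hu2, -, -, hw1, hw2, hu1, -, hw0⟩
  · refine h112 (u 2) (-x 2) 1 (-1) (z 1) (-w 1) hu2 (neg_ne_zero.2 hx2) one_ne_zero h1 hz1
      (neg_ne_zero.2 hw1) (coneR3_comb_eq_zero ?_ ?_ ?_) <;>
    (simp only [hx0, hu0, hw0, hz0, hx1, hu1, hw2, hz2]; ring)
  · refine h012 (-(2 * y 0 * w 0)) (z 1) (w 0) (-(2 * u 1 * z 1)) (y 0) (u 1)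
      (neg_ne_zero.2 (mul_ne_zero (mul_ne_zero h2 hy0) hw0)) hz1 hw0
      (neg_ne_zero.2 (mul_ne_zero (mul_ne_zero h2 hu1) hz1)) hy0 hu1
      (coneR3_comb_eq_zero ?_ ?_ ?_) <;>
    (simp only [Matrix.cons_val_zero, Matrix.cons_val_one, Matrix.cons_val_two, Matrix.head_cons,
        Matrix.tail_cons, hu0, hz0, hy1, hw1, hu2, hy2, hw2, hz2]; ring)
  · refine h021 (-(2 * v 0 * z 0)) (w 1) (z 0) (-(2 * x 1 * w 1)) (v 0) (x 1)
      (neg_ne_zero.2 (mul_ne_zero (mul_ne_zero h2 hv0) hz0)) hw1 hz0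
      (neg_ne_zero.2 (mul_ne_zero (mul_ne_zero h2 hx1) hw1)) hv0 hx1
      (coneR3_comb_eq_zero ?_ ?_ ?_) <;>
    (simp only [Matrix.cons_val_zero, Matrix.cons_val_one, Matrix.cons_val_two, Matrix.head_cons,
        Matrix.tail_cons, hx0, hw0, hv1, hz1, hx2, hv2, hz2, hw2]; ring)
  · refine h112 (u 1) (-x 1) 1 (-1) (z 0) (-w 0) hu1 (neg_ne_zero.2 hx1) one_ne_zero h1 hz0
      (neg_ne_zero.2 hw0) (coneR3_comb_eq_zero ?_ ?_ ?_) <;>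
    (simp only [hx0, hu0, hw1, hz1, hx2, hu2, hw2, hz2]; ring)

/-! ## The item -/

open Summit.MatrixMultiplication.MatrixMultiplication.Theses.ConeDesigns in
/-- **Route ConeDesigns, support `RankThreeAtMostTwo`** (item `stmt-MatrixMultiplication-9766`;
CKSU 2005 §5): for every prime `q ≥ 7`, a cone STPP design of nonzero vectors in `(ZMod q)^3`
has at most two triangles. -/
theorem rankThreeAtMostTwo_proof : RankThreeAtMostTwo := by
  intro q _ hq N a b c hnz hS
  by_contra hN
  push Not at hN
  have h2 : (2 : ZMod q) ≠ 0 := coneR3_two_ne_zero hq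
  have hex := coneR3_hexagon hnz hS
  have tri := coneR3_triangle h2 hnz hS
  -- three distinct labels
  let i₀ : Fin N := ⟨0, by omega⟩
  let i₁ : Fin N := ⟨1, by omega⟩
  let i₂ : Fin N := ⟨2, by omega⟩
  have h01 : i₀ ≠ i₁ := by simp [i₀, i₁]
  have h02 : i₀ ≠ i₂ := by simp [i₀, i₂]
  have h12 : i₁ ≠ i₂ := by simp [i₁, i₂]
  -- the first triangle is a basis; move it to the standard basis
  have hli : LinearIndependent (ZMod q) ![a i₀, b i₀, c i₀] := by
    rw [Fintype.linearIndependent_iff]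
    intro g hg
    have h := tri i₀ (g 0) (g 1) (g 2) (by simpa [Fin.sum_univ_three] using hg)
    intro i
    fin_cases i
    · exact h.1
    · exact h.2.1
    · exact h.2.2
  obtain ⟨g, hga, hgb, hgc⟩ : ∃ g : (Fin 3 → ZMod q) ≃ₗ[ZMod q] (Fin 3 → ZMod q),
      g (a i₀) = ![1, 0, 0] ∧ g (b i₀) = ![0, 1, 0] ∧ g (c i₀) = ![0, 0, 1] := by
    let B : Module.Basis (Fin 3) (ZMod q) (Fin 3 → ZMod q) :=
      basisOfLinearIndependentOfCardEqFinrank hli (by simp)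
    have hB : ⇑B = ![a i₀, b i₀, c i₀] := coe_basisOfLinearIndependentOfCardEqFinrank _ _
    have hB0 : a i₀ = B 0 := by rw [hB]; simp
    have hB1 : b i₀ = B 1 := by rw [hB]; simp
    have hB2 : c i₀ = B 2 := by rw [hB]; simp
    refine ⟨B.equivFun, ?_, ?_, ?_⟩
    · rw [hB0]; funext j; rw [Module.Basis.equivFun_self]; fin_cases j <;> simp
    · rw [hB1]; funext j; rw [Module.Basis.equivFun_self]; fin_cases j <;> simp
    · rw [hB2]; funext j; rw [Module.Basis.equivFun_self]; fin_cases j <;> simp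
  -- transport the two scalar statements along `g`
  have hex' : ∀ i j k : Fin N, ¬ (i = j ∧ j = k) → ∀ l₀ l₁ l₂ l₃ l₄ l₅ : ZMod q,
      l₀ ≠ 0 → l₁ ≠ 0 → l₂ ≠ 0 → l₃ ≠ 0 → l₄ ≠ 0 → l₅ ≠ 0 →
      l₀ • g (a i) + l₁ • g (a k) + l₂ • g (b j) + l₃ • g (b i) + l₄ • g (c k) + l₅ • g (c j)
        ≠ 0 := by
    intro i j k hijk l₀ l₁ l₂ l₃ l₄ l₅ h₀ h₁ h₂ h₃ h₄ h₅ h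
    refine hex i j k hijk l₀ l₁ l₂ l₃ l₄ l₅ h₀ h₁ h₂ h₃ h₄ h₅ (g.injective ?_)
    rw [map_zero]
    simpa only [map_add, map_smul] using h
  have tri' : ∀ i : Fin N, ∀ μ₀ μ₁ μ₂ : ZMod q,
      μ₀ • g (a i) + μ₁ • g (b i) + μ₂ • g (c i) = 0 → μ₀ = 0 ∧ μ₁ = 0 ∧ μ₂ = 0 := by
    intro i μ₀ μ₁ μ₂ h
    refine tri i μ₀ μ₁ μ₂ (g.injective ?_)
    rw [map_zero]
    simpa only [map_add, map_smul] using h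
  have havoid := coneR3_avoid hq
  -- pair (0,1)
  have P := coneR3_pair (coneR3_det_ne_zero _ _ _ (tri' i₁))
    (coneR3_hex001 h2 havoid (g (a i₁)) (g (c i₁)) (by
      have := hex' i₀ i₀ i₁ (by simp [h01]); rwa [hga, hgb, hgc] at this))
    (coneR3_hex010 h2 havoid (g (b i₁)) (g (c i₁)) (by
      have := hex' i₀ i₁ i₀ (by simp [h01]); rwa [hga, hgb, hgc] at this))
    (coneR3_hex100 h2 havoid (g (a i₁)) (g (b i₁)) (by
      have := hex' i₁ i₀ i₀ (by simp [h01.symm]); rwa [hga, hgb, hgc] at this))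
  -- pair (0,2)
  have Q := coneR3_pair (coneR3_det_ne_zero _ _ _ (tri' i₂))
    (coneR3_hex001 h2 havoid (g (a i₂)) (g (c i₂)) (by
      have := hex' i₀ i₀ i₂ (by simp [h02]); rwa [hga, hgb, hgc] at this))
    (coneR3_hex010 h2 havoid (g (b i₂)) (g (c i₂)) (by
      have := hex' i₀ i₂ i₀ (by simp [h02]); rwa [hga, hgb, hgc] at this))
    (coneR3_hex100 h2 havoid (g (a i₂)) (g (b i₂)) (by
      have := hex' i₂ i₀ i₀ (by simp [h02.symm]); rwa [hga, hgb, hgc] at this))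
  -- the triple
  exact coneR3_triple h2 P Q (hex' i₁ i₁ i₂ (by simp [h12]))
    (by have := hex' i₀ i₁ i₂ (by simp [h01]); rwa [hga, hgb] at this)
    (by have := hex' i₀ i₂ i₁ (by simp [h02]); rwa [hga, hgb] at this)

end Summit.MatrixMultiplication.MatrixMultiplication.Theorems
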